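import Mathlib
import Summits.ResolutionOfSingularities.ResolutionOfSingularities.Theorems.SandwichedSingularitiesResolution
import Literature.AlgebraicGeometry.Resolution.SandwichedWeakPatching
import Literature.AlgebraicGeometry.Resolution.LocalRegLeificationOfSandwiched
import HarnessLib

/-!
# ResolutionOfSingularities / Valuative — crux `PatchingRel`, line `sandwiched-gluing`:
# SANDʷ resolves sandwiched-singularity opens; local RegLe-ification from SANDʷ with no gluing

Crux `stmt-ResolutionOfSingularities-0642` (`Valuative.PatchingRel` = `CyclicCovers.PatchingRel`),
line `sandwiched-gluing`, gen-1 cut. For an integral separated finite-type `k`-scheme `M`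
(`char k = p`), opens `V ⊆ O ⊆ M` with `O ∖ V` regular, and `V` proper-birational over a regular
variety, the absolute atom SANDʷ(p) (`SandwichedSingularitiesResolution p`) resolves the scheme
`O` (`hasResolution_opens_of_sandwichedWeak`; used by the bridge Nagata + SANDʷ ⇒ SANDᴸ). Applied
to a morphism of proper models `φ : M → Y` with `O := φ⁻¹(Reg Y) ∪ Reg M`, a resolution of `O` is
literally the data of `ProperModel.LocalRegLeification p`
(`localRegLeification_of_sandwichedSingularitiesResolution`, stub name
`stub_localRegLeification_of_sandwichedWeak`): the gen-0 stubs S3 (gluing a STRONG resolution of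
`V` to `M ∖ cl Sing V`) and S4 (`OpenGluing`) are not needed for it. The Literature file
`SandwichedWeakPatching.lean` (refuter, cdisprove gen 6) carries a transcription
`SandwichedWeakResolution p` of the same atom (scheme arguments and hypotheses permuted) and
proves `ProperModel.localRegLeification_of_sandwichedWeakResolution`; we record the two-way
bridge (`sandwichedSingularitiesResolution_iff_sandwichedWeakResolution`) and obtain the stub from
that theorem instead of re-proving it.

## References

* O. Piltant, *An axiomatic version of Zariski's patching theorem*, RACSAM 107 (2013) 91–121,
  proof of Prop. 5.1, Steps 4–5. [Piltant2013]
-/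

-- `Summit.<Summit>.<Sub>[.Theorems]` with `Sub = Summit` (single-conjunct summit, D-0017): the duplicated
-- namespace component is the tree layout.
set_option linter.dupNamespace false

noncomputable section

namespace Summit.ResolutionOfSingularities.ResolutionOfSingularities.Theorems

open CategoryTheory AlgebraicGeometry TopologicalSpace Topology
open Literature.AlgebraicGeometry.Resolution Literature.AlgebraicGeometry.Morphisms

universe u

/-- **Bridge to the Literature transcription**: `SandwichedSingularitiesResolution p` (this
summit's conjecture leaf; scheme arguments `U X`, structure maps `f : U → Spec k`,
`g : X → Spec k`) implies `Literature.AlgebraicGeometry.Resolution.SandwichedWeakResolution p`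
(`SandwichedWeakPatching.lean`; arguments `X U`, `f : X → Spec k`, `g : U → Spec k`) — the same
statement with binders and hypotheses permuted. [folklore] -/
theorem sandwichedWeakResolution_of_sandwichedSingularitiesResolution {p : ℕ}
    (hS : SandwichedSingularitiesResolution.{u} p) : SandwichedWeakResolution.{u} p :=
  fun k _ _ X U f g V η hfs hfl hfq hX hgs hgl hgq hU hreg hpr hbir hc hout =>
    hS k U X g f V η hgs hgl hgq hU hreg hfs hfl hfq hX hpr hbir hc hout

/-- The converse bridge: `SandwichedWeakResolution p → SandwichedSingularitiesResolution p`.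
[folklore] -/
theorem sandwichedSingularitiesResolution_of_sandwichedWeakResolution {p : ℕ}
    (hS : SandwichedWeakResolution.{u} p) : SandwichedSingularitiesResolution.{u} p :=
  fun k _ _ U X f g V η hfs hfl hfq hU hreg hgs hgl hgq hX hpr hbir hc hout =>
    hS k X U g f V η hgs hgl hgq hX hfs hfl hfq hU hreg hpr hbir hc hout

/-- Hence the two transcriptions of SANDʷ(p) are equivalent. [folklore] -/
theorem sandwichedSingularitiesResolution_iff_sandwichedWeakResolution (p : ℕ) :
    SandwichedSingularitiesResolution.{u} p ↔ SandwichedWeakResolution.{u} p :=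
  ⟨sandwichedWeakResolution_of_sandwichedSingularitiesResolution,
    sandwichedSingularitiesResolution_of_sandwichedWeakResolution⟩

/-- **SANDʷ(p) resolves a sandwiched-singularity open of a variety**: for an integral separated
`k`-scheme of finite type `M` (`char k = p`), opens `V ⊆ O ⊆ M` with every point of `O ∖ V`
regular, and a proper birational `k`-morphism `η : V → U` onto a regular integral separated
finite-type `U`, SANDʷ(p) gives a resolution of the scheme `O` (it is an integral separated
finite-type `k`-scheme, regular off its open `V`, and `V ≅ O ∩ V`). [folklore] -/
theorem hasResolution_opens_of_sandwichedWeak (p : ℕ) (hS : SandwichedSingularitiesResolution.{u} p)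
    {k : Type u} [Field k] [CharP k p] {U M : Scheme.{u}} (f : U ⟶ Spec (.of k))
    (g : M ⟶ Spec (.of k)) [IsSeparated f] [LocallyOfFiniteType f] [QuasiCompact f]
    [IsIntegral U] (hU : Scheme.IsRegular U) [IsSeparated g] [LocallyOfFiniteType g]
    [QuasiCompact g] [IsIntegral M] (O V : M.Opens) (η : (V : Scheme.{u}) ⟶ U) [IsProper η]
    (hbir : IsBirational η) (hcompat : η ≫ f = V.ι ≫ g) (hVO : V ≤ O)
    (hout : ∀ x : M, x ∈ O → x ∉ V → IsRegularLocalRing (M.presheaf.stalk x))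
    [Nonempty (O : Scheme.{u})] : Scheme.HasResolution (O : Scheme.{u}) := by
  haveI : IsIntegral (O : Scheme.{u}) := isIntegral_of_isOpenImmersion O.ι
  haveI : IsLocallyNoetherian M := LocallyOfFiniteType.isLocallyNoetherian g
  haveI : CompactSpace M := QuasiCompact.compactSpace_of_compactSpace g
  haveI : IsNoetherian M := {}
  -- the sandwiched piece of `O`: `V' := O ∩ V ≅ V`
  let V' : (O : Scheme.{u}).Opens := O.ι ⁻¹ᵁ V
  let e : (V' : Scheme.{u}) ≅ (V : Scheme.{u}) := Scheme.Opens.isoOfLE hVO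
  let η' : (V' : Scheme.{u}) ⟶ U := e.hom ≫ η
  have hη'proper : IsProper η' := inferInstance
  have hη'bir : IsBirational η' := (isBirational_of_isIso e.hom).comp hbir
  have hη'compat : η' ≫ f = V'.ι ≫ (O.ι ≫ g) := by
    simp only [η', Category.assoc]
    rw [hcompat, ← Category.assoc, Scheme.Opens.isoOfLE_hom_ι, Category.assoc]
  have hout' : ∀ x : (O : Scheme.{u}), x ∉ V' →
      IsRegularLocalRing ((O : Scheme.{u}).presheaf.stalk x) := fun x hx =>
    (isRegularLocalRing_stalk_iff_of_isOpenImmersion O.ι x).mp (hout x.1 x.2 hx)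
  exact hS k U (O : Scheme.{u}) f (O.ι ≫ g) V' η' inferInstance inferInstance inferInstance
    inferInstance hU inferInstance inferInstance inferInstance inferInstance hη'proper hη'bir
    hη'compat hout'

/-- **SANDʷ(p) ⇒ local RegLe-ification in characteristic `p`**, with NO gluing: for a morphism
`φ : M → Y` of proper models of `K/k`, `char k = p`, the open `O := φ⁻¹(Reg Y) ∪ Reg M` of `M`
is regular outside `V := φ⁻¹(Reg Y)`, and `V → Reg Y` is proper and birational over the regular
`Reg Y`; a weak resolution of `O` is the data of `ProperModel.LocalRegLeification p`. This is the
Literature theorem `ProperModel.localRegLeification_of_sandwichedWeakResolution`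
(`SandwichedWeakPatching.lean`) transported along the bridge. [cite: Piltant2013, Prop. 5.1 (proof, Steps 3-4, replaced by the weak atom)] -/
theorem localRegLeification_of_sandwichedSingularitiesResolution (p : ℕ)
    (hS : SandwichedSingularitiesResolution.{u} p) : ProperModel.LocalRegLeification.{u} p :=
  ProperModel.localRegLeification_of_sandwichedWeakResolution
    (sandwichedWeakResolution_of_sandwichedSingularitiesResolution hS)

/-- **Registered stub S3′ of line `sandwiched-gluing`** (universe `0`): SANDʷ(p) gives local
RegLe-ification of morphisms of proper models in characteristic `p`. [folklore] -/
theorem stub_localRegLeification_of_sandwichedWeak :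
    ∀ p : ℕ, SandwichedSingularitiesResolution.{0} p → ProperModel.LocalRegLeification.{0} p :=
  fun p h => localRegLeification_of_sandwichedSingularitiesResolution p h

end Summit.ResolutionOfSingularities.ResolutionOfSingularities.Theorems


end
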